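import Summits.Ventures.Crystal3D.Theorems.StickyWulffConstantStackingLiminfLayerChainV4Defs
import Mathlib.Analysis.SpecialFunctions.PolarCoord
import Mathlib.MeasureTheory.Integral.Prod
import HarnessLib

/-!
# Rung R2 of line `LayerChain` v4 (crux `StackingLiminf`, stmt-Ventures-19145): the lateral kernel has
# total mass exactly `1`

Cell `crystal3d-full`, venture `Summits/Ventures/Crystal3D`.  Planner rung `rung_integral_eta`
(`HOME/cf-p1/route/lines/LayerChainV4Rungs.lean`, R2 [S]; "the line's cheapest falsifier: if the mass is
not exactly `1` the constants are off"), VERBATIM signature over the landed V4 vocabulary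
(`eta L z = (4/(π L²)) (1 − |z|²/L²)₊³`):  `∫ eta L = 1` for `L > 0`.
Proof: polar coordinates (`integral_comp_polarCoord_symm`), the angular integral `2π`, and the radial
integral `∫_0^L r (1 − r²/L²)³ dr = L²/8` by the fundamental theorem of calculus.
WHAT THIS IS NOT: anything about the crux; a calculus identity.
-/

noncomputable section

namespace Summit.Ventures.Crystal3D.Theorems

open MeasureTheory Set Real intervalIntegral
open Summit.Ventures.Crystal3D.Cruxes.StackingLiminf.LayerChainV4

/-- The radial profile `r (1 − r²/L²)₊³` and its primitive. -/
theorem hasDerivAt_eta_radial_primitive (L r : ℝ) (hL : 0 < L) :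
    HasDerivAt (fun s : ℝ => -(L ^ 2 / 8) * (1 - s * s / L ^ 2) ^ 4)
      (r * (1 - r * r / L ^ 2) ^ 3) r := by
  have h1 : HasDerivAt (fun s : ℝ => 1 - s * s / L ^ 2) (-((1 * r + r * 1) / L ^ 2)) r :=
    (((hasDerivAt_id r).mul (hasDerivAt_id r)).div_const (L ^ 2)).const_sub 1
  have h2 := (h1.pow 4).const_mul (-(L ^ 2 / 8))
  have hL2 : L ^ 2 ≠ 0 := pow_ne_zero 2 hL.ne'
  refine h2.congr_deriv ?_
  push_cast
  field_simp
  ring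

/-- The radial integral: `∫_{r > 0} r (1 − r²/L²)₊³ dr = L²/8`. -/
theorem integral_eta_radial (L : ℝ) (hL : 0 < L) :
    ∫ r in Ioi (0 : ℝ), r * max 0 (1 - r ^ 2 / L ^ 2) ^ 3 = L ^ 2 / 8 := by
  have hcont : Continuous fun r : ℝ => r * max 0 (1 - r ^ 2 / L ^ 2) ^ 3 := by fun_prop
  -- beyond `L` the integrand vanishes
  have hzero : ∀ r, L ≤ r → r * max 0 (1 - r ^ 2 / L ^ 2) ^ 3 = 0 := by
    intro r hr
    have : max 0 (1 - r ^ 2 / L ^ 2) = 0 := by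
      refine max_eq_left ?_
      rw [sub_nonpos, le_div_iff₀ (by positivity), one_mul]
      exact pow_le_pow_left₀ hL.le hr 2
    rw [this, zero_pow three_ne_zero, mul_zero]
  have hsupp : HasCompactSupport fun r : ℝ => r * max 0 (1 - r ^ 2 / L ^ 2) ^ 3 := by
    refine HasCompactSupport.intro (isCompact_Icc (a := -L) (b := L)) fun r hr => ?_
    rw [mem_Icc, not_and_or, not_le, not_le] at hr
    rcases hr with hr | hr
    · have : max 0 (1 - r ^ 2 / L ^ 2) = 0 := by
        refine max_eq_left ?_
        rw [sub_nonpos, le_div_iff₀ (by positivity), one_mul]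
        nlinarith
      rw [this, zero_pow three_ne_zero, mul_zero]
    · exact hzero r hr.le
  have hint : Integrable fun r : ℝ => r * max 0 (1 - r ^ 2 / L ^ 2) ^ 3 :=
    hcont.integrable_of_hasCompactSupport hsupp
  rw [← Ioc_union_Ioi_eq_Ioi hL.le, setIntegral_union (Set.Ioc_disjoint_Ioi le_rfl)
    measurableSet_Ioi hint.integrableOn hint.integrableOn,
    setIntegral_eq_zero_of_forall_eq_zero (t := Ioi L) fun r hr => hzero r (le_of_lt (mem_Ioi.1 hr)),
    add_zero,
    ← integral_of_le hL.le]
  -- on `[0, L]` the positive part is the polynomial itself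
  have heq : EqOn (fun r : ℝ => r * max 0 (1 - r ^ 2 / L ^ 2) ^ 3)
      (fun r => r * (1 - r * r / L ^ 2) ^ 3) (uIcc 0 L) := by
    intro r hr
    rw [uIcc_of_le hL.le, mem_Icc] at hr
    have : 0 ≤ 1 - r ^ 2 / L ^ 2 := by
      rw [sub_nonneg, div_le_one (by positivity)]
      exact pow_le_pow_left₀ hr.1 hr.2 2
    simp only
    rw [max_eq_right this]
    ring
  rw [integral_congr heq,
    integral_eq_sub_of_hasDerivAt (fun r _ => hasDerivAt_eta_radial_primitive L r hL)
      (by apply Continuous.intervalIntegrable; fun_prop)]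
  have hL2 : L ^ 2 ≠ 0 := pow_ne_zero 2 hL.ne'
  field_simp
  ring

/-- **R2 — the lateral bump has total mass exactly `1`**: `∫ (4/(πL²)) (1 − |z|²/L²)₊³ dz = 1`. -/
theorem rung_integral_eta (L : ℝ) (hL : 0 < L) : ∫ z, eta L z = 1 := by
  rw [← integral_comp_polarCoord_symm]
  have hrad : ∀ p : ℝ × ℝ, p.1 • eta L (polarCoord.symm p) =
      (fun r : ℝ => r * max 0 (1 - r ^ 2 / L ^ 2) ^ 3) p.1 •
        (fun _ : ℝ => 4 / (Real.pi * L ^ 2)) p.2 := by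
    intro p
    simp only [polarCoord_symm_apply, eta, smul_eq_mul]
    have : (p.1 * Real.cos p.2) ^ 2 + (p.1 * Real.sin p.2) ^ 2 = p.1 ^ 2 := by
      nlinarith [Real.sin_sq_add_cos_sq p.2]
    rw [this]
    ring
  rw [polarCoord_target, Measure.volume_eq_prod]
  calc ∫ p in Ioi (0 : ℝ) ×ˢ Ioo (-Real.pi) Real.pi, p.1 • eta L (polarCoord.symm p)
        ∂((volume : Measure ℝ).prod (volume : Measure ℝ))
      = ∫ p in Ioi (0 : ℝ) ×ˢ Ioo (-Real.pi) Real.pi,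
          (fun r : ℝ => r * max 0 (1 - r ^ 2 / L ^ 2) ^ 3) p.1 •
            (fun _ : ℝ => 4 / (Real.pi * L ^ 2)) p.2
          ∂((volume : Measure ℝ).prod (volume : Measure ℝ)) :=
        setIntegral_congr_fun (measurableSet_Ioi.prod measurableSet_Ioo) fun p _ => hrad p
    _ = (∫ r in Ioi (0 : ℝ), r * max 0 (1 - r ^ 2 / L ^ 2) ^ 3) •
          ∫ _θ in Ioo (-Real.pi) Real.pi, (4 / (Real.pi * L ^ 2) : ℝ) := by
        rw [← Measure.prod_restrict]
        exact integral_prod_smul (fun r : ℝ => r * max 0 (1 - r ^ 2 / L ^ 2) ^ 3)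
          (fun _ : ℝ => (4 / (Real.pi * L ^ 2) : ℝ))
    _ = 1 := by
        rw [integral_eta_radial L hL, setIntegral_const,
          Real.volume_real_Ioo_of_le (by linarith [Real.pi_pos]), smul_eq_mul, smul_eq_mul]
        have hL2 : L ^ 2 ≠ 0 := pow_ne_zero 2 hL.ne'
        field_simp
        ring

end Summit.Ventures.Crystal3D.Theorems

end
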